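import Summits.Ventures.HodgeRepro2.T5HeckeDoubleCoset

/-!
# The degree of `T_g` is `[K : K ∩ gKg⁻¹]`; the counting form of unimodularity as an index identity

Kernel annex of the Tier-5 record (blind lane).  `T5HeckeDoubleCoset` identifies the stabiliser of
`gK` in `K` with `K ∩ gKg⁻¹`; with Mathlib's `MulAction.index_stabilizer` this gives the classical
degree formula and turns the counting form of unimodularity used by `T5HeckeAdjoint` /
`T5HeckeStar` / `T5HeckeSelfAdjoint` (`hU : #(Kg⁻¹K/K) = #(KgK/K)`) into pure group theory:

* `ncard_orbit_eq_relIndex` — `#(KgK/K) = [K : K ∩ gKg⁻¹]` (as `(gKg⁻¹).relIndex K`);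
* `ncard_orbit_inv_eq_relIndex` — `#(Kg⁻¹K/K) = [gKg⁻¹ : K ∩ gKg⁻¹]` (as `K.relIndex (gKg⁻¹)`,
  by conjugation invariance of the relative index);
* `ncard_orbit_inv_eq_iff` — **`#(Kg⁻¹K/K) = #(KgK/K)` iff `[gKg⁻¹ : K ∩ gKg⁻¹] = [K : K ∩ gKg⁻¹]`**:
  the counting form of unimodularity says exactly that `K` and its conjugates `gKg⁻¹` have the
  same «volume» relative to their intersection (the Haar-measure statement `μ(gKg⁻¹) = μ(K)`);
* `ncard_orbit_eq_one_of_mem_normalizer` — degree `1` for `g ∈ N_G(K)`.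

What stays prose: that a reductive `p`-adic group is unimodular (so that the identity holds for
every `g`); the printed theorems.
-/

namespace Summit.Ventures.HodgeRepro2.T5HeckeDegreeIndex

variable {G : Type*} [Group G] (K : Subgroup G)

/-- `gKg⁻¹` as the image of `K` under conjugation by `g`. -/
abbrev conjK (g : G) : Subgroup G := K.map (MulAut.conj g).toMonoidHom

/-- `x ∈ gKg⁻¹ ↔ g⁻¹ x g ∈ K`. -/
theorem mem_conjK_iff (g x : G) : x ∈ conjK K g ↔ g⁻¹ * x * g ∈ K := by
  constructor
  · rintro ⟨y, hy, rfl⟩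
    simp only [MulEquiv.toMonoidHom_eq_coe, MonoidHom.coe_coe, MulAut.conj_apply]
    have : g⁻¹ * (g * y * g⁻¹) * g = y := by group
    rw [this]
    exact hy
  · intro h
    refine ⟨g⁻¹ * x * g, h, ?_⟩
    simp only [MulEquiv.toMonoidHom_eq_coe, MonoidHom.coe_coe, MulAut.conj_apply]
    group

/-- `g⁻¹Kg` is the preimage of `K` under conjugation by `g`. -/
theorem conjK_inv_eq_comap (g : G) :
    conjK K g⁻¹ = K.comap (MulAut.conj g).toMonoidHom := by
  ext x
  rw [mem_conjK_iff, Subgroup.mem_comap]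
  simp only [inv_inv, MulEquiv.toMonoidHom_eq_coe, MonoidHom.coe_coe, MulAut.conj_apply]

/-- **The degree formula**: `#(KgK/K) = [K : K ∩ gKg⁻¹]`, written as the relative index
`(gKg⁻¹).relIndex K`. -/
theorem ncard_orbit_eq_relIndex (g : G) :
    (MulAction.orbit K ((g : G) : G ⧸ K)).ncard = (conjK K g).relIndex K := by
  rw [← MulAction.index_stabilizer, T5HeckeDoubleCoset.stabilizer_coset_eq]
  rfl

/-- `#(KgK/K) = (K ⊓ gKg⁻¹).relIndex K = [K : K ∩ gKg⁻¹]`. -/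
theorem ncard_orbit_eq_relIndex_inf (g : G) :
    (MulAction.orbit K ((g : G) : G ⧸ K)).ncard = (K ⊓ conjK K g).relIndex K := by
  rw [ncard_orbit_eq_relIndex, Subgroup.inf_relIndex_left]

/-- `#(Kg⁻¹K/K) = K.relIndex (gKg⁻¹) = [gKg⁻¹ : K ∩ gKg⁻¹]` (conjugation invariance of the
relative index: `(g⁻¹Kg).relIndex K = K.relIndex (gKg⁻¹)`). -/
theorem ncard_orbit_inv_eq_relIndex (g : G) :
    (MulAction.orbit K ((g⁻¹ : G) : G ⧸ K)).ncard = K.relIndex (conjK K g) := by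
  rw [ncard_orbit_eq_relIndex, conjK_inv_eq_comap, Subgroup.relIndex_comap]

/-- `#(Kg⁻¹K/K) = (K ⊓ gKg⁻¹).relIndex (gKg⁻¹) = [gKg⁻¹ : K ∩ gKg⁻¹]`. -/
theorem ncard_orbit_inv_eq_relIndex_inf (g : G) :
    (MulAction.orbit K ((g⁻¹ : G) : G ⧸ K)).ncard = (K ⊓ conjK K g).relIndex (conjK K g) := by
  rw [ncard_orbit_inv_eq_relIndex, Subgroup.inf_relIndex_right]

/-- **The counting form of unimodularity is an index identity**:
`#(Kg⁻¹K/K) = #(KgK/K)` iff `[gKg⁻¹ : K ∩ gKg⁻¹] = [K : K ∩ gKg⁻¹]`. -/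
theorem ncard_orbit_inv_eq_iff (g : G) :
    (MulAction.orbit K ((g⁻¹ : G) : G ⧸ K)).ncard = (MulAction.orbit K ((g : G) : G ⧸ K)).ncard ↔
      (K ⊓ conjK K g).relIndex (conjK K g) = (K ⊓ conjK K g).relIndex K := by
  rw [ncard_orbit_inv_eq_relIndex_inf, ncard_orbit_eq_relIndex_inf]

/-- For `g ∈ N_G(K)`: `gKg⁻¹ = K`. -/
theorem conjK_eq_of_mem_normalizer {g : G} (hg : g ∈ Subgroup.normalizer (K : Set G)) :
    conjK K g = K := by
  ext x
  rw [mem_conjK_iff]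
  exact (Subgroup.mem_normalizer_iff''.1 hg x).symm

/-- Degree `1` for `g ∈ N_G(K)`: `#(KgK/K) = 1`. -/
theorem ncard_orbit_eq_one_of_mem_normalizer {g : G} (hg : g ∈ Subgroup.normalizer (K : Set G)) :
    (MulAction.orbit K ((g : G) : G ⧸ K)).ncard = 1 := by
  rw [ncard_orbit_eq_relIndex, conjK_eq_of_mem_normalizer K hg, Subgroup.relIndex_self]

end Summit.Ventures.HodgeRepro2.T5HeckeDegreeIndex
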